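import Summits.MatrixMultiplication.OmegaCensus.C2Quaternion16Prelim
import HarnessLib

/-!
# Towards `β(C₂ × Q₁₆) = 32`: the shape `(1,2 | 1,2 | 2,2)` with `⟨c₀⟩`-invariant `U` descends to `ℤ₂ × ℤ₄`

ω-census, family (b3).  Framing: lottery ticket; floor = certified bounds/negative ranges.

Helpers for the shape exclusions at `|A| = 16` (`two_set_criterion_fst/mid`: the two-set criterion read off a periodic
`1 × 2 × 2` box; `triple_of_sum_injOn`), and the descent case of the shape `(1,2 | 1,2 | 2,2)` in `G(ℤ₂ × ℤ₈, (0,4))`: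
if both parts of `U` are `⟨c₀⟩`-cosets, the exact vertex `111` projects to the forbidden tiling of `ℤ₂ × ℤ₄`
(`no_36_shape_f_coset`).
-/

namespace Summit.MatrixMultiplication.OmegaCensus

open Literature.Combinatorics.Additive Finset

section Helpers

variable {A : Type*} [AddCommGroup A] [DecidableEq A]

omit [DecidableEq A] in
/-- Componentwise injectivity read off `Set.InjOn` on a box. [folklore] -/
theorem triple_of_sum_injOn {X Y Z : Finset A}
    (h : Set.InjOn (fun p : A × A × A => p.1 + p.2.1 + p.2.2) ↑(X ×ˢ Y ×ˢ Z)) :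
    ∀ a ∈ X, ∀ a' ∈ X, ∀ b ∈ Y, ∀ b' ∈ Y, ∀ c ∈ Z, ∀ c' ∈ Z, a + b + c = a' + b' + c' →
      a = a' ∧ b = b' ∧ c = c' := by
  intro a ha a' ha' b hb b' hb' c hc c' hc' he
  have h1 : ((a, b, c) : A × A × A) ∈ (↑(X ×ˢ Y ×ˢ Z) : Set (A × A × A)) := by simp [ha, hb, hc]
  have h2 : ((a', b', c') : A × A × A) ∈ (↑(X ×ˢ Y ×ˢ Z) : Set (A × A × A)) := by simp [ha', hb', hc']
  have key := h h1 h2 he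
  simp only [Prod.mk.injEq] at key
  exact key

/-- The two-set criterion for a periodic box `{x} × {y₁,y₂} × {z₁,z₂}` (`c₀ ≠ 0 = 2c₀`). [folklore] -/
theorem two_set_criterion_fst {x y₁ y₂ z₁ z₂ c₀ : A} (hc₀ : c₀ ≠ 0) (h2c : c₀ + c₀ = 0) (hy : y₁ ≠ y₂)
    (hz : z₁ ≠ z₂)
    (hper : ((({x} : Finset A) ×ˢ ({y₁, y₂} : Finset A) ×ˢ ({z₁, z₂} : Finset A)).image
        fun p : A × A × A => p.1 + p.2.1 + p.2.2).image (· + c₀) =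
      (({x} : Finset A) ×ˢ ({y₁, y₂} : Finset A) ×ˢ ({z₁, z₂} : Finset A)).image
        fun p : A × A × A => p.1 + p.2.1 + p.2.2) :
    y₂ - y₁ = c₀ ∨ z₂ - z₁ = c₀ ∨ ((y₂ - y₁) + (y₂ - y₁) = 0 ∧ (y₂ - y₁) + (z₂ - z₁) = c₀) := by
  apply two_set_sum_periodic hc₀ h2c (sub_ne_zero.2 hy.symm) (sub_ne_zero.2 hz.symm)
  intro q hq
  have hmem : ∀ b ∈ ({y₁, y₂} : Finset A), ∀ c ∈ ({z₁, z₂} : Finset A), x + b + c ∈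
      (({x} : Finset A) ×ˢ ({y₁, y₂} : Finset A) ×ˢ ({z₁, z₂} : Finset A)).image
        fun p : A × A × A => p.1 + p.2.1 + p.2.2 :=
    fun b hb c hc => mem_sumset₃.2 ⟨x, mem_singleton_self _, b, hb, c, hc, rfl⟩
  have hq' : x + y₁ + z₁ + q ∈ (({x} : Finset A) ×ˢ ({y₁, y₂} : Finset A) ×ˢ ({z₁, z₂} : Finset A)).image
      fun p : A × A × A => p.1 + p.2.1 + p.2.2 := by
    simp only [mem_insert, mem_singleton] at hq
    rcases hq with rfl | rfl | rfl | rfl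
    · rw [add_zero]; exact hmem y₁ (by simp) z₁ (by simp)
    · rw [show x + y₁ + z₁ + (z₂ - z₁) = x + y₁ + z₂ by abel]; exact hmem y₁ (by simp) z₂ (by simp)
    · rw [show x + y₁ + z₁ + (y₂ - y₁) = x + y₂ + z₁ by abel]; exact hmem y₂ (by simp) z₁ (by simp)
    · rw [show x + y₁ + z₁ + (y₂ - y₁ + (z₂ - z₁)) = x + y₂ + z₂ by abel]; exact hmem y₂ (by simp) z₂ (by simp)
  have hqc : x + y₁ + z₁ + q + c₀ ∈ (({x} : Finset A) ×ˢ ({y₁, y₂} : Finset A) ×ˢ ({z₁, z₂} : Finset A)).image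
      fun p : A × A × A => p.1 + p.2.1 + p.2.2 := by rw [← hper]; exact mem_image_of_mem _ hq'
  rw [mem_sumset₃] at hqc
  obtain ⟨a, ha, b, hb, c, hc, he⟩ := hqc
  rw [mem_singleton] at ha
  rw [mem_insert, mem_singleton] at hb hc
  simp only [mem_insert, mem_singleton]
  rcases hb with hb | hb <;> rcases hc with hc | hc <;> rw [ha, hb, hc] at he
  · left; linear_combination (norm := abel1) -he
  · right; left; linear_combination (norm := abel1) -he
  · right; right; left; linear_combination (norm := abel1) -he
  · right; right; right; linear_combination (norm := abel1) -he

/-- The two-set criterion for a periodic box `{x₁,x₂} × {y} × {z₁,z₂}`. [folklore] -/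
theorem two_set_criterion_mid {x₁ x₂ y z₁ z₂ c₀ : A} (hc₀ : c₀ ≠ 0) (h2c : c₀ + c₀ = 0) (hx : x₁ ≠ x₂)
    (hz : z₁ ≠ z₂)
    (hper : ((({x₁, x₂} : Finset A) ×ˢ ({y} : Finset A) ×ˢ ({z₁, z₂} : Finset A)).image
        fun p : A × A × A => p.1 + p.2.1 + p.2.2).image (· + c₀) =
      (({x₁, x₂} : Finset A) ×ˢ ({y} : Finset A) ×ˢ ({z₁, z₂} : Finset A)).image
        fun p : A × A × A => p.1 + p.2.1 + p.2.2) :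
    x₂ - x₁ = c₀ ∨ z₂ - z₁ = c₀ ∨ ((x₂ - x₁) + (x₂ - x₁) = 0 ∧ (x₂ - x₁) + (z₂ - z₁) = c₀) := by
  apply two_set_sum_periodic hc₀ h2c (sub_ne_zero.2 hx.symm) (sub_ne_zero.2 hz.symm)
  intro q hq
  have hmem : ∀ a ∈ ({x₁, x₂} : Finset A), ∀ c ∈ ({z₁, z₂} : Finset A), a + y + c ∈
      (({x₁, x₂} : Finset A) ×ˢ ({y} : Finset A) ×ˢ ({z₁, z₂} : Finset A)).image
        fun p : A × A × A => p.1 + p.2.1 + p.2.2 :=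
    fun a ha c hc => mem_sumset₃.2 ⟨a, ha, y, mem_singleton_self _, c, hc, rfl⟩
  have hq' : x₁ + y + z₁ + q ∈ (({x₁, x₂} : Finset A) ×ˢ ({y} : Finset A) ×ˢ ({z₁, z₂} : Finset A)).image
      fun p : A × A × A => p.1 + p.2.1 + p.2.2 := by
    simp only [mem_insert, mem_singleton] at hq
    rcases hq with rfl | rfl | rfl | rfl
    · rw [add_zero]; exact hmem x₁ (by simp) z₁ (by simp)
    · rw [show x₁ + y + z₁ + (z₂ - z₁) = x₁ + y + z₂ by abel]; exact hmem x₁ (by simp) z₂ (by simp)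
    · rw [show x₁ + y + z₁ + (x₂ - x₁) = x₂ + y + z₁ by abel]; exact hmem x₂ (by simp) z₁ (by simp)
    · rw [show x₁ + y + z₁ + (x₂ - x₁ + (z₂ - z₁)) = x₂ + y + z₂ by abel]; exact hmem x₂ (by simp) z₂ (by simp)
  have hqc : x₁ + y + z₁ + q + c₀ ∈ (({x₁, x₂} : Finset A) ×ˢ ({y} : Finset A) ×ˢ ({z₁, z₂} : Finset A)).image
      fun p : A × A × A => p.1 + p.2.1 + p.2.2 := by rw [← hper]; exact mem_image_of_mem _ hq'
  rw [mem_sumset₃] at hqc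
  obtain ⟨a, ha, b, hb, c, hc, he⟩ := hqc
  rw [mem_singleton] at hb
  rw [mem_insert, mem_singleton] at ha hc
  simp only [mem_insert, mem_singleton]
  rcases ha with ha | ha <;> rcases hc with hc | hc <;> rw [ha, hb, hc] at he
  · left; linear_combination (norm := abel1) -he
  · right; left; linear_combination (norm := abel1) -he
  · right; right; left; linear_combination (norm := abel1) -he
  · right; right; right; linear_combination (norm := abel1) -he

end Helpers

section Coset

variable {G : Type} [Group G] [DecidableEq G] {ρ τ : ZMod 2 × ZMod 8 → G} {S T U : Finset G}

/-- **Descent case of the shape `(1,2 | 1,2 | 2,2)`**: if `U₀` and `U₁` are both `⟨c₀⟩`-invariant, no such TPP triple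
exists in `G(ℤ₂ × ℤ₈, (0,4))`. [folklore] -/
theorem no_36_shape_f_coset
    (hρρ : ∀ a b, ρ a * ρ b = ρ (a + b)) (hρτ : ∀ a b, ρ a * τ b = τ (b - a))
    (hτρ : ∀ a b, τ a * ρ b = τ (a + b))
    (hττ : ∀ a b, τ a * τ b = ρ (((0 : ZMod 2), (4 : ZMod 8)) + b - a))
    (hρ : Function.Injective ρ) (hτ : Function.Injective τ) (hne : ∀ a b, ρ a ≠ τ b)
    (h : TripleProductProperty S T U)
    (hs₀ : (univ.filter fun a : ZMod 2 × ZMod 8 => ρ a ∈ S).card = 1)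
    (hs₁ : (univ.filter fun a : ZMod 2 × ZMod 8 => τ a ∈ S).card = 2)
    (ht₀ : (univ.filter fun a : ZMod 2 × ZMod 8 => ρ a ∈ T).card = 1)
    (ht₁ : (univ.filter fun a : ZMod 2 × ZMod 8 => τ a ∈ T).card = 2)
    (hU₀c : ∀ z ∈ (univ.filter fun a : ZMod 2 × ZMod 8 => ρ a ∈ U), z + ((0 : ZMod 2), (4 : ZMod 8)) ∈
      (univ.filter fun a : ZMod 2 × ZMod 8 => ρ a ∈ U))
    (hU₁c : ∀ z ∈ (univ.filter fun a : ZMod 2 × ZMod 8 => τ a ∈ U), z + ((0 : ZMod 2), (4 : ZMod 8)) ∈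
      (univ.filter fun a : ZMod 2 × ZMod 8 => τ a ∈ U))
    (hU₀ne : (univ.filter fun a : ZMod 2 × ZMod 8 => ρ a ∈ U).Nonempty)
    (hU₁ne : (univ.filter fun a : ZMod 2 × ZMod 8 => τ a ∈ U).Nonempty) : False := by
  set c₀ : ZMod 2 × ZMod 8 := ((0 : ZMod 2), (4 : ZMod 8)) with hc₀def
  have hc₀ : c₀ ≠ 0 := by rw [hc₀def]; decide
  have h2c : c₀ + c₀ = 0 := two_c0_eq_zero hρτ hτρ hττ hτ
  set S₀ : Finset (ZMod 2 × ZMod 8) := univ.filter fun a => ρ a ∈ S with hS₀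
  set S₁ : Finset (ZMod 2 × ZMod 8) := univ.filter fun a => τ a ∈ S with hS₁
  set T₀ : Finset (ZMod 2 × ZMod 8) := univ.filter fun a => ρ a ∈ T with hT₀
  set T₁ : Finset (ZMod 2 × ZMod 8) := univ.filter fun a => τ a ∈ T with hT₁
  set U₀ : Finset (ZMod 2 × ZMod 8) := univ.filter fun a => ρ a ∈ U with hU₀
  set U₁ : Finset (ZMod 2 × ZMod 8) := univ.filter fun a => τ a ∈ U with hU₁
  have mS₀ : ∀ a ∈ S₀, cond false (τ a) (ρ a) ∈ S := fun a ha => by simpa [hS₀] using ha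
  have mS₁ : ∀ a ∈ S₁, cond true (τ a) (ρ a) ∈ S := fun a ha => by simpa [hS₁] using ha
  have mT₀ : ∀ a ∈ T₀, cond false (τ a) (ρ a) ∈ T := fun a ha => by simpa [hT₀] using ha
  have mT₁ : ∀ a ∈ T₁, cond true (τ a) (ρ a) ∈ T := fun a ha => by simpa [hT₁] using ha
  have mU₀ : ∀ a ∈ U₀, cond false (τ a) (ρ a) ∈ U := fun a ha => by simpa [hU₀] using ha
  have mU₁ : ∀ a ∈ U₁, cond true (τ a) (ρ a) ∈ U := fun a ha => by simpa [hU₁] using ha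
  have inj := sum_injOn' hρρ hττ hρ hτ h
  obtain ⟨a₀, hS₀a⟩ := card_eq_one.1 hs₀
  obtain ⟨t, hT₀t⟩ := card_eq_one.1 ht₀
  obtain ⟨s₁, s₂, hs12, hS₁eq⟩ := card_eq_two.1 hs₁
  obtain ⟨t₁, t₂, ht12, hT₁eq⟩ := card_eq_two.1 ht₁
  have hs₁m : s₁ ∈ S₁ := by rw [hS₁eq]; simp
  have hs₂m : s₂ ∈ S₁ := by rw [hS₁eq]; simp
  have ht₁m : t₁ ∈ T₁ := by rw [hT₁eq]; simp
  have ht₂m : t₂ ∈ T₁ := by rw [hT₁eq]; simp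
  obtain ⟨u₁, hu₁⟩ := hU₀ne
  obtain ⟨v₁, hv₁⟩ := hU₁ne
  have absU₀ : ∀ z ∈ U₀, ∀ κ : ZMod 2 × ZMod 8, (κ = 0 ∨ κ = c₀) → z + κ ∈ U₀ := by
    rintro z hz κ (rfl | rfl)
    · rw [add_zero]; exact hz
    · exact hU₀c z hz
  have absU₁ : ∀ z ∈ U₁, ∀ κ : ZMod 2 × ZMod 8, (κ = 0 ∨ κ = c₀) → z + κ ∈ U₁ := by
    rintro z hz κ (rfl | rfl)
    · rw [add_zero]; exact hz
    · exact hU₁c z hz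
  -- boxes of the vertex `111`
  set X := (S₁ ×ˢ T₁ ×ˢ U₀).image fun p : (ZMod 2 × ZMod 8) × (ZMod 2 × ZMod 8) × (ZMod 2 × ZMod 8) =>
    p.1 + p.2.1 + p.2.2 with hX
  set Y := (S₁ ×ˢ T₀ ×ˢ U₁).image fun p : (ZMod 2 × ZMod 8) × (ZMod 2 × ZMod 8) × (ZMod 2 × ZMod 8) =>
    p.1 + p.2.1 + p.2.2 with hY
  set Z := (S₀ ×ˢ T₁ ×ˢ U₁).image fun p : (ZMod 2 × ZMod 8) × (ZMod 2 × ZMod 8) × (ZMod 2 × ZMod 8) =>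
    p.1 + p.2.1 + p.2.2 with hZ
  have dYZ : Disjoint Y Z := (disjoint_sumset₁' hρρ hρτ hτρ hττ hne h) true mS₁ mT₀ mU₁ mS₀ mT₁
  have dXY : Disjoint X Y := (disjoint_sumset₂' hρρ hρτ hτρ hττ hne h) true mS₁ mT₁ mU₀ mS₁ mT₀ mU₁
  have dZX : Disjoint Z X := (disjoint_sumset₃' hρρ hρτ hτρ hττ hne h) true mS₀ mT₁ mU₁ mS₁ mU₀
  have mX : ∀ a ∈ S₁, ∀ b ∈ T₁, ∀ c ∈ U₀, a + b + c ∈ X := fun a ha b hb c hc => by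
    rw [hX]; exact mem_sumset₃.2 ⟨a, ha, b, hb, c, hc, rfl⟩
  have mY : ∀ a ∈ S₁, ∀ c ∈ U₁, a + t + c ∈ Y := fun a ha c hc => by
    rw [hY]; exact mem_sumset₃.2 ⟨a, ha, t, by rw [hT₀t]; exact mem_singleton_self _, c, hc, rfl⟩
  have mZ : ∀ b ∈ T₁, ∀ c ∈ U₁, a₀ + b + c ∈ Z := fun b hb c hc => by
    rw [hZ]; exact mem_sumset₃.2 ⟨a₀, by rw [hS₀a]; exact mem_singleton_self _, b, hb, c, hc, rfl⟩
  have iX := triple_of_sum_injOn (inj true true false mS₁ mT₁ mU₀)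
  have htm : t ∈ T₀ := by rw [hT₀t]; exact mem_singleton_self _
  have iY := triple_of_sum_injOn (inj true false true mS₁ mT₀ mU₁)
  have iZ := pairs_of_sum_injOn_fst (by rw [← hS₀a]; exact inj false true true mS₀ mT₁ mU₁)
  -- the parts `S₁`, `T₁` are not periodic (else two periodic factors in an injective box)
  have hdT : t₂ - t₁ ≠ c₀ := by
    intro hh
    have := iZ t₁ ht₁m t₂ ht₂m (v₁ + c₀) (hU₁c v₁ hv₁) v₁ hv₁ (by rw [← hh]; abel)
    exact ht12 this.1
  have hdS : s₂ - s₁ ≠ c₀ := by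
    intro hh
    have := iY s₁ hs₁m s₂ hs₂m t htm t htm (v₁ + c₀) (hU₁c v₁ hv₁) v₁ hv₁ (by rw [← hh]; abel)
    exact hs12 this.1
  -- projection
  set π : ZMod 2 × ZMod 8 →+ ZMod 2 × ZMod 4 := (AddMonoidHom.fst (ZMod 2) (ZMod 8)).prod
    ((ZMod.castHom (show 4 ∣ 8 by norm_num) (ZMod 4)).toAddMonoidHom.comp (AddMonoidHom.snd (ZMod 2) (ZMod 8)))
    with hπ
  have keyκ : ∀ P Q : ZMod 2 × ZMod 8, π P = π Q → ∃ κ, (κ = 0 ∨ κ = c₀) ∧ Q = P + κ := by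
    intro P Q hPQ
    rw [hπ] at hPQ
    rcases (proj84_eq_iff P Q).1 hPQ with e | e
    · exact ⟨0, Or.inl rfl, by rw [add_zero]; exact e⟩
    · exact ⟨c₀, Or.inr rfl, e⟩
  have key0 : ∀ P : ZMod 2 × ZMod 8, π P = 0 → ∃ κ, (κ = 0 ∨ κ = c₀) ∧ P = κ := by
    intro P hP
    obtain ⟨κ, hκ, e⟩ := keyκ 0 P (by rw [map_zero, hP])
    exact ⟨κ, hκ, by rw [e, zero_add]⟩
  -- clashes
  have clashXY : ∀ a ∈ S₁, ∀ b ∈ T₁, ∀ c ∈ U₀, ∀ a' ∈ S₁, ∀ c' ∈ U₁, ∀ κ : ZMod 2 × ZMod 8,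
      (κ = 0 ∨ κ = c₀) → a' + t + c' = a + b + c + κ → False := by
    intro a ha b hb c hc a' ha' c' hc' κ hκ e
    refine disjoint_left.1 dXY ?_ (mY a' ha' c' hc')
    rw [e, show a + b + c + κ = a + b + (c + κ) by abel]; exact mX a ha b hb _ (absU₀ c hc κ hκ)
  have clashXZ : ∀ a ∈ S₁, ∀ b ∈ T₁, ∀ c ∈ U₀, ∀ b' ∈ T₁, ∀ c' ∈ U₁, ∀ κ : ZMod 2 × ZMod 8,
      (κ = 0 ∨ κ = c₀) → a₀ + b' + c' = a + b + c + κ → False := by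
    intro a ha b hb c hc b' hb' c' hc' κ hκ e
    refine disjoint_left.1 dZX (mZ b' hb' c' hc') ?_
    rw [e, show a + b + c + κ = a + b + (c + κ) by abel]; exact mX a ha b hb _ (absU₀ c hc κ hκ)
  have clashYZ : ∀ b ∈ T₁, ∀ c ∈ U₁, ∀ a' ∈ S₁, ∀ c' ∈ U₁, ∀ κ : ZMod 2 × ZMod 8,
      (κ = 0 ∨ κ = c₀) → a₀ + b + c = a' + t + c' + κ → False := by
    intro b hb c hc a' ha' c' hc' κ hκ e
    refine disjoint_left.1 dYZ ?_ (mZ b hb c hc)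
    rw [e, show a' + t + c' + κ = a' + t + (c' + κ) by abel]; exact mY a' ha' _ (absU₁ c' hc' κ hκ)
  refine z2z4_no_exact_tiling (π (t₂ - t₁)) (π (s₂ - s₁)) (π (t + v₁ - t₁ - u₁)) (π (a₀ + v₁ - s₁ - u₁))
    ?_ ?_ ?_ ?_ ?_ ?_ ?_ ?_ ?_ ?_ ?_ ?_
  · intro hh
    obtain ⟨κ, hκ, e⟩ := key0 _ hh
    rcases hκ with rfl | rfl
    · exact ht12 (by linear_combination (norm := abel1) -e)
    · exact hdT e
  · intro hh
    obtain ⟨κ, hκ, e⟩ := key0 _ hh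
    rcases hκ with rfl | rfl
    · exact hs12 (by linear_combination (norm := abel1) -e)
    · exact hdS e
  · intro hh
    obtain ⟨κ, hκ, e⟩ := keyκ _ _ hh
    exact hs12.symm (iX s₂ hs₂m s₁ hs₁m t₁ ht₁m t₂ ht₂m u₁ hu₁ (u₁ + κ) (absU₀ u₁ hu₁ κ hκ)
      (by linear_combination (norm := abel1) e)).1
  · intro hh
    rw [← map_add] at hh
    obtain ⟨κ, hκ, e⟩ := key0 _ hh
    exact hs12.symm (iX s₂ hs₂m s₁ hs₁m t₂ ht₂m t₁ ht₁m u₁ hu₁ (u₁ + κ) (absU₀ u₁ hu₁ κ hκ)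
      (by linear_combination (norm := abel1) e)).1
  · intro hh
    simp only [mem_insert, mem_singleton, ← map_add] at hh
    rcases hh with hh | hh | hh | hh
    · obtain ⟨κ, hκ, e⟩ := key0 _ hh
      exact clashXY s₁ hs₁m t₁ ht₁m u₁ hu₁ s₁ hs₁m v₁ hv₁ κ hκ (by linear_combination (norm := abel1) e)
    · obtain ⟨κ, hκ, e⟩ := keyκ _ _ hh.symm
      exact clashXY s₁ hs₁m t₂ ht₂m u₁ hu₁ s₁ hs₁m v₁ hv₁ κ hκ (by linear_combination (norm := abel1) e)
    · obtain ⟨κ, hκ, e⟩ := keyκ _ _ hh.symm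
      exact clashXY s₂ hs₂m t₁ ht₁m u₁ hu₁ s₁ hs₁m v₁ hv₁ κ hκ (by linear_combination (norm := abel1) e)
    · obtain ⟨κ, hκ, e⟩ := keyκ _ _ hh.symm
      exact clashXY s₂ hs₂m t₂ ht₂m u₁ hu₁ s₁ hs₁m v₁ hv₁ κ hκ (by linear_combination (norm := abel1) e)
  · intro hh
    simp only [mem_insert, mem_singleton, ← map_add] at hh
    rcases hh with hh | hh | hh | hh
    · obtain ⟨κ, hκ, e⟩ := key0 _ hh
      exact clashXY s₁ hs₁m t₁ ht₁m u₁ hu₁ s₂ hs₂m v₁ hv₁ κ hκ (by linear_combination (norm := abel1) e)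
    · obtain ⟨κ, hκ, e⟩ := keyκ _ _ hh.symm
      exact clashXY s₁ hs₁m t₂ ht₂m u₁ hu₁ s₂ hs₂m v₁ hv₁ κ hκ (by linear_combination (norm := abel1) e)
    · obtain ⟨κ, hκ, e⟩ := keyκ _ _ hh.symm
      exact clashXY s₂ hs₂m t₁ ht₁m u₁ hu₁ s₂ hs₂m v₁ hv₁ κ hκ (by linear_combination (norm := abel1) e)
    · obtain ⟨κ, hκ, e⟩ := keyκ _ _ hh.symm
      exact clashXY s₂ hs₂m t₂ ht₂m u₁ hu₁ s₂ hs₂m v₁ hv₁ κ hκ (by linear_combination (norm := abel1) e)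
  · intro hh
    simp only [mem_insert, mem_singleton, ← map_add] at hh
    rcases hh with hh | hh | hh | hh
    · obtain ⟨κ, hκ, e⟩ := key0 _ hh
      exact clashXZ s₁ hs₁m t₁ ht₁m u₁ hu₁ t₁ ht₁m v₁ hv₁ κ hκ (by linear_combination (norm := abel1) e)
    · obtain ⟨κ, hκ, e⟩ := keyκ _ _ hh.symm
      exact clashXZ s₁ hs₁m t₂ ht₂m u₁ hu₁ t₁ ht₁m v₁ hv₁ κ hκ (by linear_combination (norm := abel1) e)
    · obtain ⟨κ, hκ, e⟩ := keyκ _ _ hh.symm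
      exact clashXZ s₂ hs₂m t₁ ht₁m u₁ hu₁ t₁ ht₁m v₁ hv₁ κ hκ (by linear_combination (norm := abel1) e)
    · obtain ⟨κ, hκ, e⟩ := keyκ _ _ hh.symm
      exact clashXZ s₂ hs₂m t₂ ht₂m u₁ hu₁ t₁ ht₁m v₁ hv₁ κ hκ (by linear_combination (norm := abel1) e)
  · intro hh
    simp only [mem_insert, mem_singleton, ← map_add] at hh
    rcases hh with hh | hh | hh | hh
    · obtain ⟨κ, hκ, e⟩ := key0 _ hh
      exact clashXZ s₁ hs₁m t₁ ht₁m u₁ hu₁ t₂ ht₂m v₁ hv₁ κ hκ (by linear_combination (norm := abel1) e)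
    · obtain ⟨κ, hκ, e⟩ := keyκ _ _ hh.symm
      exact clashXZ s₁ hs₁m t₂ ht₂m u₁ hu₁ t₂ ht₂m v₁ hv₁ κ hκ (by linear_combination (norm := abel1) e)
    · obtain ⟨κ, hκ, e⟩ := keyκ _ _ hh.symm
      exact clashXZ s₂ hs₂m t₁ ht₁m u₁ hu₁ t₂ ht₂m v₁ hv₁ κ hκ (by linear_combination (norm := abel1) e)
    · obtain ⟨κ, hκ, e⟩ := keyκ _ _ hh.symm
      exact clashXZ s₂ hs₂m t₂ ht₂m u₁ hu₁ t₂ ht₂m v₁ hv₁ κ hκ (by linear_combination (norm := abel1) e)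
  · intro hh
    obtain ⟨κ, hκ, e⟩ := keyκ _ _ hh
    exact clashYZ t₁ ht₁m v₁ hv₁ s₁ hs₁m v₁ hv₁ κ hκ (by linear_combination (norm := abel1) e)
  · intro hh
    rw [← map_add] at hh
    obtain ⟨κ, hκ, e⟩ := keyκ _ _ hh
    exact clashYZ t₂ ht₂m v₁ hv₁ s₁ hs₁m v₁ hv₁ κ hκ (by linear_combination (norm := abel1) e)
  · intro hh
    rw [← map_add] at hh
    obtain ⟨κ, hκ, e⟩ := keyκ _ _ hh
    exact clashYZ t₁ ht₁m v₁ hv₁ s₂ hs₂m v₁ hv₁ κ hκ (by linear_combination (norm := abel1) e)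
  · intro hh
    rw [← map_add, ← map_add] at hh
    obtain ⟨κ, hκ, e⟩ := keyκ _ _ hh
    exact clashYZ t₂ ht₂m v₁ hv₁ s₂ hs₂m v₁ hv₁ κ hκ (by linear_combination (norm := abel1) e)

end Coset

end Summit.MatrixMultiplication.OmegaCensus
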